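import Mathlib.NumberTheory.Real.Irrational
import Mathlib.Analysis.SpecialFunctions.Pow.Real
import Mathlib.LinearAlgebra.Dimension.Constructions
import Literature.NumberTheory.Irrationality.FischlerZudilin2010.RefinedCriterion
import Literature.NumberTheory.Transcendental.PeriodsWave0
import HarnessLib

/-!
# ζ(5) search — the DIMENSION route to "one of ζ(5), ζ(7)" (cell `pub-zeta5`, family lane `fam-indep`)

HONEST FRAMING: systematic search; no irrationality claim unless certified.

Criterion-side companion of `CriteriaOneOf.lean` for the cell's intermediate target **T2** ("at least
one of `ζ(5), ζ(7)` is irrational"). `CriteriaOneOf.lean` types the ELIMINATION route (forms in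
`1, ζ(5), ζ(7)` with `ζ(3)` absent; margin `c + φ - δ > 0`). This file types the LINEAR-INDEPENDENCE
(dimension) route, in which `ζ(3)` is NOT eliminated:

* `finrank_span_range_le_card` / `exists_irrational_of_card_lt_finrank` — linear algebra: if `1` and every
  "unsuspected" `θ j` lie in the `ℚ`-span of a finite set `S` of reals and
  `card S < dim_ℚ Span_ℚ(θ)`, then some suspected `θ j` is irrational.
* `zetaFiveOrSeven_of_finrank_three` — `dim_ℚ Span_ℚ(1, ζ(3), ζ(5), ζ(7)) ≥ 3 ⇒ ζ(5) ∉ ℚ ∨ ζ(7) ∉ ℚ`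
  (T2 by name); `zetaFiveSevenNine_of_finrank_three'` — the same from
  `dim_ℚ Span_ℚ(1, ζ(3), ζ(5), ζ(7), ζ(9)) ≥ 3` ("one of `ζ(5), ζ(7), ζ(9)`", which would already improve
  Zudilin's "one of `ζ(5), …, ζ(11)`", tree `Literature.NumberTheory.Transcendental.zudilin`).
* `finrank_three_of_divisorForms` — the **Fischler–Zudilin refined criterion** (Math. Ann. 347 (2010),
  Theorem 2; tree `Literature.NumberTheory.Irrationality.FischlerZudilin2010.theorem2_holds`, PROVED) in the
  cell's RATE units (`CRITERIA.md` §0): INTEGER forms `L_n = ∑ i, ℓ n i · θ i` in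
  `θ = (1, ζ(3), ζ(5), ζ(7))` of exact size `|L_n|^{1/n} → e^{-σ}` (`σ > 0`), coefficients
  `|ℓ n i| ≤ e^{Q' n}` for all large `n` for every `Q' > Q > 0`, a common divisor `δ n ∣ ℓ n i` (`i ≠ 0`,
  i.e. of the three zeta-coefficients) with `e^{ψ n} ≤ gcd(δ n, δ (n+1))` for large `n`, and the MARGIN
  `Q < σ + ψ`, give `dim ≥ 3`; `zetaFiveOrSeven_of_divisorForms` composes with the previous item.
  With `δ n = d_n^3` (the printed divisor of Ball–Rivoal-type forms, Fischler–Zudilin Prop. 2 (10)) the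
  prime number theorem gives `ψ = 3`; with `δ n = 1` (`ψ = 0`) this is Nesterenko's criterion
  `dim ≥ 1 + σ/Q > 2`.

REQUIREMENT (the T2 target seen from the criterion side, `families/indep/FAMILY.md` §5): a family with
forms in `1, ζ(3), ζ(5), ζ(7)` must deliver `σ - Q + ψ > 0`; the Ball–Rivoal/Zudilin/Fischler–Zudilin
very-well-poised family at `s = 4` delivers `σ - Q + 3 = -9.28` nats/step at best (`t = 1`).
Everything here is PROVED (implications only); no named fact, no `sorry`, no certificate is constructed.
-/

noncomputable section

open Filter Topology Finset
open Literature.NumberTheory.Transcendental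

namespace Summit.KontsevichZagierPeriods.Zeta5Search

/-! ### Linear algebra: a dimension count forces an irrational among the suspects -/

/-- If every `θ j` lies in the `ℚ`-span of a finite set `S` of reals, then
`dim_ℚ Span_ℚ(range θ) ≤ card S`. -/
theorem finrank_span_range_le_card {ι : Type*} (θ : ι → ℝ) (S : Finset ℝ)
    (h : ∀ j, θ j ∈ Submodule.span ℚ (S : Set ℝ)) :
    Module.finrank ℚ (Submodule.span ℚ (Set.range θ)) ≤ S.card := by
  have hle : Submodule.span ℚ (Set.range θ) ≤ Submodule.span ℚ (S : Set ℝ) :=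
    Submodule.span_le.2 (by rintro _ ⟨j, rfl⟩; exact h j)
  exact (Submodule.finrank_mono hle).trans (finrank_span_finset_le_card S)

/-- **Dimension ⇒ "one of".** Let `θ : ι → ℝ`, a finite set `S ⊂ ℝ` whose `ℚ`-span contains `1`
and every `θ j` with `j ∉ T` (`T` = the "suspects"). If `card S < dim_ℚ Span_ℚ(range θ)` then some
`θ j`, `j ∈ T`, is irrational (were they all rational, `range θ ⊆ Span_ℚ S` and the dimension would
be `≤ card S`). -/
theorem exists_irrational_of_card_lt_finrank {ι : Type*} (θ : ι → ℝ) (S : Finset ℝ) (T : Finset ι)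
    (h1 : (1 : ℝ) ∈ Submodule.span ℚ (S : Set ℝ))
    (hgen : ∀ j, j ∉ T → θ j ∈ Submodule.span ℚ (S : Set ℝ))
    (hcard : S.card < Module.finrank ℚ (Submodule.span ℚ (Set.range θ))) :
    ∃ j ∈ T, Irrational (θ j) := by
  by_contra hcon
  push Not at hcon
  have hall : ∀ j, θ j ∈ Submodule.span ℚ (S : Set ℝ) := by
    intro j
    by_cases hj : j ∈ T
    · have hrat : ∃ q : ℚ, (q : ℝ) = θ j := by
        have := hcon j hj
        unfold Irrational at this
        push Not at this
        exact this
      obtain ⟨q, hq⟩ := hrat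
      rw [← hq, ← Rat.smul_one_eq_cast ℝ q]
      exact Submodule.smul_mem _ q h1
    · exact hgen j hj
  have hle := finrank_span_range_le_card θ S hall
  omega

/-! ### T2 by name: `dim_ℚ Span_ℚ(1, ζ(3), ζ(5), ζ(7)) ≥ 3 ⇒ one of ζ(5), ζ(7)` -/

/-- The vector `(1, ζ(3), ζ(5), ζ(7))`. -/
def thetaFour : Fin 4 → ℝ := ![(1 : ℝ), zetaValue 3, zetaValue 5, zetaValue 7]

/-- The vector `(1, ζ(3), ζ(5), ζ(7), ζ(9))`. -/
def thetaFive : Fin 5 → ℝ := ![(1 : ℝ), zetaValue 3, zetaValue 5, zetaValue 7, zetaValue 9]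

/-- `thetaFour 0 = 1`. -/
@[simp] theorem thetaFour_zero : thetaFour 0 = 1 := rfl
/-- `thetaFour 1 = ζ(3)`. -/
@[simp] theorem thetaFour_one : thetaFour 1 = zetaValue 3 := rfl
/-- `thetaFour 2 = ζ(5)`. -/
@[simp] theorem thetaFour_two : thetaFour 2 = zetaValue 5 := rfl
/-- `thetaFour 3 = ζ(7)`. -/
@[simp] theorem thetaFour_three : thetaFour 3 = zetaValue 7 := rfl
/-- `thetaFive 0 = 1`. -/
@[simp] theorem thetaFive_zero : thetaFive 0 = 1 := rfl
/-- `thetaFive 1 = ζ(3)`. -/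
@[simp] theorem thetaFive_one : thetaFive 1 = zetaValue 3 := rfl
/-- `thetaFive 2 = ζ(5)`. -/
@[simp] theorem thetaFive_two : thetaFive 2 = zetaValue 5 := rfl
/-- `thetaFive 3 = ζ(7)`. -/
@[simp] theorem thetaFive_three : thetaFive 3 = zetaValue 7 := rfl
/-- `thetaFive 4 = ζ(9)`. -/
@[simp] theorem thetaFive_four : thetaFive 4 = zetaValue 9 := rfl

/-- `1 ∈ Span_ℚ {1, ζ(3)}`. -/
private theorem one_mem_spanPair :
    (1 : ℝ) ∈ Submodule.span ℚ ((({1, zetaValue 3} : Finset ℝ) : Set ℝ)) :=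
  Submodule.subset_span (by simp)

/-- `ζ(3) ∈ Span_ℚ {1, ζ(3)}`. -/
private theorem zetaThree_mem_spanPair :
    zetaValue 3 ∈ Submodule.span ℚ ((({1, zetaValue 3} : Finset ℝ) : Set ℝ)) :=
  Submodule.subset_span (by simp)

/-- **T2 from a dimension bound.** If `dim_ℚ Span_ℚ(1, ζ(3), ζ(5), ζ(7)) ≥ 3` then at least one of
`ζ(5), ζ(7)` is irrational: otherwise the span lies in `ℚ + ℚ ζ(3)`, of dimension `≤ 2`.
(The standard conjecture is dimension `4`; in print the smallest `κ` with
`dim_ℚ Span_ℚ(1, ζ(3), …, ζ(κ)) ≥ 3` known is `κ = 139`, Fischler–Zudilin 2010 Thm 3, and `κ = 75` is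
CLAIMED by a computer-assisted computation, Lai arXiv:2407.14236 Claim 1.4.) -/
theorem zetaFiveOrSeven_of_finrank_three
    (h : 3 ≤ Module.finrank ℚ (Submodule.span ℚ (Set.range thetaFour))) :
    Irrational (zetaValue 5) ∨ Irrational (zetaValue 7) := by
  have hcardS : ({1, zetaValue 3} : Finset ℝ).card ≤ 2 := Finset.card_le_two
  obtain ⟨j, hj, hirr⟩ := exists_irrational_of_card_lt_finrank thetaFour {1, zetaValue 3}
    ({2, 3} : Finset (Fin 4)) one_mem_spanPair
    (by
      intro j hj
      fin_cases j
      · simpa using one_mem_spanPair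
      · simpa using zetaThree_mem_spanPair
      · simp at hj
      · simp at hj)
    (by omega)
  simp only [Finset.mem_insert, Finset.mem_singleton] at hj
  rcases hj with rfl | rfl
  · exact Or.inl (by simpa using hirr)
  · exact Or.inr (by simpa using hirr)

/-- **"One of `ζ(5), ζ(7), ζ(9)`" from a dimension bound**: `dim_ℚ Span_ℚ(1, ζ(3), ζ(5), ζ(7), ζ(9)) ≥ 3`
forces one of `ζ(5), ζ(7), ζ(9)` to be irrational (else the span lies in `ℚ + ℚ ζ(3)`). -/
theorem zetaFiveSevenNine_of_finrank_three'
    (h : 3 ≤ Module.finrank ℚ (Submodule.span ℚ (Set.range thetaFive))) :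
    Irrational (zetaValue 5) ∨ Irrational (zetaValue 7) ∨ Irrational (zetaValue 9) := by
  have hcardS : ({1, zetaValue 3} : Finset ℝ).card ≤ 2 := Finset.card_le_two
  obtain ⟨j, hj, hirr⟩ := exists_irrational_of_card_lt_finrank thetaFive {1, zetaValue 3}
    ({2, 3, 4} : Finset (Fin 5)) one_mem_spanPair
    (by
      intro j hj
      fin_cases j
      · simpa using one_mem_spanPair
      · simpa using zetaThree_mem_spanPair
      · simp at hj
      · simp at hj
      · simp at hj)
    (by omega)
  simp only [Finset.mem_insert, Finset.mem_singleton] at hj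
  rcases hj with rfl | rfl | rfl
  · exact Or.inl (by simpa using hirr)
  · exact Or.inr (Or.inl (by simpa using hirr))
  · exact Or.inr (Or.inr (by simpa using hirr))

/-- Bookkeeping: T2 via the dimension route also implies the tree's statement `zudilin`. -/
theorem zudilin_of_finrank_three
    (h : 3 ≤ Module.finrank ℚ (Submodule.span ℚ (Set.range thetaFour))) : zudilin := by
  rcases zetaFiveOrSeven_of_finrank_three h with h5 | h7
  · exact Or.inl h5
  · exact Or.inr (Or.inl h7)

/-! ### Rate bookkeeping: `n`-th roots versus exponential rates -/

/-- `x ≤ bⁿ ⇒ x^{1/n} ≤ b` (`x, b ≥ 0`, `n ≥ 1`). -/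
private theorem rpow_inv_le_of_le_pow {x b : ℝ} {n : ℕ} (hx : 0 ≤ x) (hb : 0 ≤ b) (hn : 1 ≤ n)
    (h : x ≤ b ^ n) : x ^ ((1 : ℝ) / n) ≤ b := by
  have hn' : (0 : ℝ) < n := by exact_mod_cast hn
  calc x ^ ((1 : ℝ) / n) ≤ (b ^ n) ^ ((1 : ℝ) / n) := Real.rpow_le_rpow hx h (by positivity)
    _ = b := by
      rw [← Real.rpow_natCast, ← Real.rpow_mul hb, mul_one_div_cancel hn'.ne', Real.rpow_one]

/-- `bⁿ ≤ y ⇒ b ≤ y^{1/n}` (`b ≥ 0`, `n ≥ 1`). -/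
private theorem le_rpow_inv_of_pow_le {y b : ℝ} {n : ℕ} (hb : 0 ≤ b) (hn : 1 ≤ n)
    (h : b ^ n ≤ y) : b ≤ y ^ ((1 : ℝ) / n) := by
  have hn' : (0 : ℝ) < n := by exact_mod_cast hn
  calc b = (b ^ n) ^ ((1 : ℝ) / n) := by
        rw [← Real.rpow_natCast, ← Real.rpow_mul hb, mul_one_div_cancel hn'.ne', Real.rpow_one]
    _ ≤ y ^ ((1 : ℝ) / n) := Real.rpow_le_rpow (pow_nonneg hb n) h (by positivity)

/-! ### The Fischler–Zudilin refined criterion in rate units, at `(1, ζ(3), ζ(5), ζ(7))` -/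

/-- **Fischler–Zudilin Theorem 2 in the cell's rate units (`CRITERIA.md` §0), general `θ`.**
Integer forms `L_n = ∑ i, ℓ n i · θ i` in `θ : Fin (r+1) → ℝ` (`r ≥ 1`) with
* exact size `|L_n|^{1/n} → e^{-σ}`, `σ > 0`;
* coefficients `|ℓ n i| ≤ e^{Q' n}` for all large `n`, for every `Q' > Q` (`Q > 0`);
* a common divisor `δ n > 0` of the `ℓ n i`, `i ≠ 0` (all `n ≥ 1`), with
  `e^{ψ n} ≤ gcd(δ n, δ (n+1))` for all large `n`;
* the MARGIN `Q < σ + ψ`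
give `dim_ℚ Span_ℚ(θ) ≥ 3`. This is `FischlerZudilin2010.theorem2_holds` (PROVED in the tree) with
`α = e^{-σ}`, `β = e^{Q}`, `g = e^{ψ}`. -/
theorem finrank_three_of_divisorForms_general (r : ℕ) (hr : 1 ≤ r) (θ : Fin (r + 1) → ℝ)
    (ℓ : ℕ → Fin (r + 1) → ℤ) (δ : ℕ → ℕ) {σ Q ψ : ℝ} (hσ : 0 < σ) (hQ : 0 < Q)
    (hL : Tendsto (fun n : ℕ => |∑ i, (ℓ n i : ℝ) * θ i| ^ ((1 : ℝ) / n)) atTop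
      (𝓝 (Real.exp (-σ))))
    (hℓ : ∀ i, ∀ Q' : ℝ, Q < Q' → ∀ᶠ n : ℕ in atTop, |(ℓ n i : ℝ)| ≤ Real.exp (Q' * n))
    (hδ : ∀ n : ℕ, 1 ≤ n → 0 < δ n ∧ ∀ i : Fin (r + 1), i ≠ 0 → (δ n : ℤ) ∣ ℓ n i)
    (hg : ∀ᶠ n : ℕ in atTop, Real.exp (ψ * n) ≤ ((Nat.gcd (δ n) (δ (n + 1)) : ℕ) : ℝ))
    (hmargin : Q < σ + ψ) :
    3 ≤ Module.finrank ℚ (Submodule.span ℚ (Set.range θ)) := by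
  have hα : 0 < Real.exp (-σ) := Real.exp_pos _
  have hα1 : Real.exp (-σ) < 1 := Real.exp_lt_one_iff.2 (by linarith)
  have hβ : 1 < Real.exp Q := Real.one_lt_exp_iff.2 hQ
  have hℓ' : ∀ i, ∀ β' : ℝ, Real.exp Q < β' →
      ∀ᶠ n : ℕ in atTop, |(ℓ n i : ℝ)| ^ ((1 : ℝ) / n) ≤ β' := by
    intro i β' hβ'
    have hβ'0 : 0 < β' := (Real.exp_pos Q).trans hβ'
    have hQ' : Q < Real.log β' := by
      rw [Real.lt_log_iff_exp_lt hβ'0]; exact hβ'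
    filter_upwards [hℓ i (Real.log β') hQ', eventually_ge_atTop 1] with n hn hn1
    refine rpow_inv_le_of_le_pow (abs_nonneg _) hβ'0.le hn1 ?_
    have e : Real.exp (Real.log β' * n) = β' ^ n := by
      rw [mul_comm, Real.exp_nat_mul, Real.exp_log hβ'0]
    rw [← e]; exact hn
  have hg' : ∃ g : ℝ, Real.exp (-σ) * Real.exp Q < g ∧
      ∀ᶠ n : ℕ in atTop, g ≤ ((Nat.gcd (δ n) (δ (n + 1)) : ℕ) : ℝ) ^ ((1 : ℝ) / n) := by
    refine ⟨Real.exp ψ, ?_, ?_⟩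
    · rw [← Real.exp_add]; exact Real.exp_lt_exp.2 (by linarith)
    · filter_upwards [hg, eventually_ge_atTop 1] with n hn hn1
      refine le_rpow_inv_of_pow_le (Real.exp_pos ψ).le hn1 ?_
      have e : Real.exp ψ ^ n = Real.exp (ψ * n) := by rw [mul_comm, Real.exp_nat_mul]
      rw [e]; exact hn
  exact Literature.NumberTheory.Irrationality.FischlerZudilin2010.theorem2_holds r θ ℓ
    (Real.exp (-σ)) (Real.exp Q) δ hr hα hα1 hβ hL hℓ' hδ hg'

/-- **The dimension route to T2, criterion form.** Integer forms
`L_n = ℓ n 0 + ℓ n 1 ζ(3) + ℓ n 2 ζ(5) + ℓ n 3 ζ(7)` with exact size `e^{-σ n}`, coefficients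
`≤ e^{Q' n}` (all `Q' > Q > 0`), a common divisor `δ n` of the three zeta-coefficients with
`e^{ψ n} ≤ gcd(δ n, δ (n+1))` eventually, and margin `Q < σ + ψ`, give
`dim_ℚ Span_ℚ(1, ζ(3), ζ(5), ζ(7)) ≥ 3`. For Ball–Rivoal-type forms `δ n = d_n^3` and `ψ = 3`
(Fischler–Zudilin 2010 Prop. 2 (10) + PNT); no family meeting the margin at `s = 4` is known. -/
theorem finrank_three_of_divisorForms (ℓ : ℕ → Fin 4 → ℤ) (δ : ℕ → ℕ) {σ Q ψ : ℝ}
    (hσ : 0 < σ) (hQ : 0 < Q)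
    (hL : Tendsto (fun n : ℕ => |∑ i, (ℓ n i : ℝ) * thetaFour i| ^ ((1 : ℝ) / n)) atTop
      (𝓝 (Real.exp (-σ))))
    (hℓ : ∀ i, ∀ Q' : ℝ, Q < Q' → ∀ᶠ n : ℕ in atTop, |(ℓ n i : ℝ)| ≤ Real.exp (Q' * n))
    (hδ : ∀ n : ℕ, 1 ≤ n → 0 < δ n ∧ ∀ i : Fin 4, i ≠ 0 → (δ n : ℤ) ∣ ℓ n i)
    (hg : ∀ᶠ n : ℕ in atTop, Real.exp (ψ * n) ≤ ((Nat.gcd (δ n) (δ (n + 1)) : ℕ) : ℝ))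
    (hmargin : Q < σ + ψ) :
    3 ≤ Module.finrank ℚ (Submodule.span ℚ (Set.range thetaFour)) :=
  finrank_three_of_divisorForms_general 3 (by norm_num) thetaFour ℓ δ hσ hQ hL hℓ hδ hg hmargin

/-- **T2 via Fischler–Zudilin (the implication the `fam-indep` lane measures `σ - Q + ψ` against).**
Under the hypotheses of `finrank_three_of_divisorForms`: `ζ(5) ∉ ℚ ∨ ζ(7) ∉ ℚ`. -/
theorem zetaFiveOrSeven_of_divisorForms (ℓ : ℕ → Fin 4 → ℤ) (δ : ℕ → ℕ) {σ Q ψ : ℝ}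
    (hσ : 0 < σ) (hQ : 0 < Q)
    (hL : Tendsto (fun n : ℕ => |∑ i, (ℓ n i : ℝ) * thetaFour i| ^ ((1 : ℝ) / n)) atTop
      (𝓝 (Real.exp (-σ))))
    (hℓ : ∀ i, ∀ Q' : ℝ, Q < Q' → ∀ᶠ n : ℕ in atTop, |(ℓ n i : ℝ)| ≤ Real.exp (Q' * n))
    (hδ : ∀ n : ℕ, 1 ≤ n → 0 < δ n ∧ ∀ i : Fin 4, i ≠ 0 → (δ n : ℤ) ∣ ℓ n i)
    (hg : ∀ᶠ n : ℕ in atTop, Real.exp (ψ * n) ≤ ((Nat.gcd (δ n) (δ (n + 1)) : ℕ) : ℝ))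
    (hmargin : Q < σ + ψ) :
    Irrational (zetaValue 5) ∨ Irrational (zetaValue 7) :=
  zetaFiveOrSeven_of_finrank_three (finrank_three_of_divisorForms ℓ δ hσ hQ hL hℓ hδ hg hmargin)

/-- **"One of `ζ(5), ζ(7), ζ(9)`" via Fischler–Zudilin** at `θ = (1, ζ(3), ζ(5), ζ(7), ζ(9))`
(`s = 5` in the Ball–Rivoal/Fischler–Zudilin indexing): same hypotheses, five coordinates. -/
theorem zetaFiveSevenNine_of_divisorForms (ℓ : ℕ → Fin 5 → ℤ) (δ : ℕ → ℕ) {σ Q ψ : ℝ}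
    (hσ : 0 < σ) (hQ : 0 < Q)
    (hL : Tendsto (fun n : ℕ => |∑ i, (ℓ n i : ℝ) * thetaFive i| ^ ((1 : ℝ) / n)) atTop
      (𝓝 (Real.exp (-σ))))
    (hℓ : ∀ i, ∀ Q' : ℝ, Q < Q' → ∀ᶠ n : ℕ in atTop, |(ℓ n i : ℝ)| ≤ Real.exp (Q' * n))
    (hδ : ∀ n : ℕ, 1 ≤ n → 0 < δ n ∧ ∀ i : Fin 5, i ≠ 0 → (δ n : ℤ) ∣ ℓ n i)
    (hg : ∀ᶠ n : ℕ in atTop, Real.exp (ψ * n) ≤ ((Nat.gcd (δ n) (δ (n + 1)) : ℕ) : ℝ))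
    (hmargin : Q < σ + ψ) :
    Irrational (zetaValue 5) ∨ Irrational (zetaValue 7) ∨ Irrational (zetaValue 9) :=
  zetaFiveSevenNine_of_finrank_three'
    (finrank_three_of_divisorForms_general 4 (by norm_num) thetaFive ℓ δ hσ hQ hL hℓ hδ hg hmargin)

end Summit.KontsevichZagierPeriods.Zeta5Search
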